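/-
Copyright (c) 2026 the pub-hodgecm-mathlib formalisation cell (harness21).  Prover seat hodgecm-mathlib-LH7-p04 (g3), 2026-09-02 (LH7 leaf ED. 3 road,
O8b census residual (iii): «an automorphic representation on which a subgroup with dense orbit acts by a character IS that character»).
-/
import Literature.NumberTheory.Automorphic.AutomorphicQuotientSubgroupErgodic
import Literature.NumberTheory.Automorphic.AutomorphicCharacterLineUnique
import HarnessLib

/-!
# Eigenfunctions of a subgroup of `G(𝔸_K)` with dense orbit: the `ψ⁻¹`-eigenspace of `M` in `L²(G(𝔸_K) ⧸ A_G G(K))` is the line `ℂ [ψ̄]`;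
# discrete automorphic representations on which `M` acts by scalars

Topic `NumberTheory/Automorphic`; THEOREMS ONLY (no definition, no instance, no named fact, no notation, no `sorry`).  The `M`-versions (`M ≤ G(𝔸_K)`
a CLOSED NORMAL subgroup with `M · (A_G · G(K))` DENSE in `G(𝔸_K)`) of ★ `AutomorphicQuotientErgodic` §«eigenfunctions» and of ★
`AutomorphicCharacterLineUnique` (both of which need the scalar action of ALL of `G(𝔸_K)`), over the ergodicity of `M` on the automorphic quotient
(★ `AdelicGroupData.ergodicSMul_subgroup_automorphicQuotient`, Moore's lemma [Zimmer1984] §2.2 Cor. 2.2.3):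

* §1 `AdelicGroupData.coeFn_smul_ae_eq_of_forall_mem_rightRegular_apply_eq_smul` (a.e. form of `R(m) f = χ(m) f`, `m ∈ M`),
  `AdelicGroupData.inner_coeFn_ae_eq_const_of_forall_mem` (for two `χ`-eigenfunctions `a ≠ 0`, `b` OF `M`, `x ↦ ⟪a x, b x⟫` is a.e. the constant
  `⟪a, b⟫ / μ(X)`), `AdelicGroupData.eq_zero_of_inner_eq_zero_of_forall_mem_rightRegular_apply_eq_smul` (**a `χ`-eigenfunction of `M` orthogonal to
  a non-zero `χ`-eigenfunction of `M` vanishes**).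
* §2 `AutomorphicCharacter.mem_lineSubrep_of_forall_mem_rightRegular_apply_eq_smul` ∕ `mem_lineSubrep_iff_forall_mem_rightRegular_apply_eq_smul` —
  **the `ψ⁻¹`-eigenspace OF `M` in `L²` is the line `ℂ [ψ̄]`** (★ `lineSubrep`) for an automorphic character `ψ` (★ `AutomorphicCharacter`);
  `closedSubrep_le_lineSubrep_of_forall_mem_apply_eq_smul` ∕ `closedSubrep_eq_lineSubrep_of_forall_mem_apply_eq_smul`.
* §3 **`DiscreteAutomorphicRep.eq_ofChar_of_forall_mem_apply_eq_smul`** — a discrete automorphic representation on which `M` acts by the scalars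
  `ψ(m)⁻¹` IS `ofChar ψ μ` (★), hence one-dimensional (`isOneDimensional_of_forall_mem_apply_eq_smul`) and unique (`eq_of_forall_mem_apply_eq_smul`),
  and ALL of `G(𝔸_K)` acts on it by `ψ(g)⁻¹`.

CONSUMER (cell `hodgecm-mathlib`, crux H413 = stmt-HodgeConjecture-24833, line LH7, leaf ED. 3 print organ O8b `PKmultOneU2Shape`): with `M` = the
image of `U(Φ₂)(𝔸_{L⁺,f})` in `U(Φ₂)(𝔸_{L⁺})` (density = weak approximation at `∞` for `U(Φ₂)`, [PlatonovRapinchuk1994] §7.3 Prop. 7.8) and `ψ` the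
automorphic character `((η ψ) ∘ det)⁻¹` (★ `cmDetChar`), the head «`U(Φ₂)(𝔸_{L⁺,f})` acts on `P₂` by `ψ`» of the (O8b♭-ADELIC-FIN) brick gives
`P₂ = ofChar ψ μ₂` by §3, i.e. residual (iii) «archimedean places» of the O8b census is reduced to weak approximation; ★
`F0P3cPKtupleU2LineUnique.pkMultOneU2Shape_of_isotypy` then closes O8b in-house.  Nothing here is specific to unitary groups.
HONEST LABEL: generic `L²` bookkeeping; HC_CM is proved only modulo the printed citations of that programme until its rung 0 closes; this file proves
no printed citation of it.

## References
* [Zimmer1984] R. J. Zimmer, *Ergodic theory and semisimple groups*, Monographs in Math. 81 (1984), §2.2 Cor. 2.2.3 (Moore's ergodicity duality).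
* [Gelbart1975] S. Gelbart, *Automorphic forms on adele groups*, Ann. of Math. Stud. 83 (1975), §2.A; Thm. 10.10 (proof, p. 158: orthogonal
  eigenfunctions with the same character).
* [PlatonovRapinchuk1994] V. Platonov, A. Rapinchuk, *Algebraic Groups and Number Theory* (1994), §7.3 Prop. 7.8.
-/

set_option autoImplicit false

noncomputable section

open MeasureTheory Filter Set Topology
open scoped ENNReal Pointwise InnerProductSpace

namespace Literature.NumberTheory.Automorphic

/-! ## §1 `M`-eigenfunctions in `L²` of the automorphic quotient -/

namespace AdelicGroupData

universe u

variable {K : Type} [Field K] [NumberField K] (𝒢 : AdelicGroupData.{u} K)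
  [LocallyCompactSpace 𝒢.Adelic] [SecondCountableTopology 𝒢.Adelic]
  (μ : Measure 𝒢.automorphicQuotient) [𝒢.IsAutomorphicMeasure μ]
  (M : Subgroup 𝒢.Adelic) [M.Normal]

omit [LocallyCompactSpace 𝒢.Adelic] [SecondCountableTopology 𝒢.Adelic] [M.Normal] in
/-- The a.e. form of an `M`-eigen-identity `R(m) f = χ(m) f` (`m ∈ M`) in `L²` of the automorphic quotient: `f (m • x) = χ(m⁻¹) f x` for a.e. `x`,
for every `m ∈ M` (★ `rightRegular_apply_coeFn`). [cite: Zimmer1984, §2.2] -/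
theorem coeFn_smul_ae_eq_of_forall_mem_rightRegular_apply_eq_smul {f : 𝒢.L2 μ} {χ : 𝒢.Adelic → ℂ}
    (hf : ∀ m ∈ M, 𝒢.rightRegular μ m f = χ m • f) {m : 𝒢.Adelic} (hm : m ∈ M) :
    ∀ᵐ x ∂μ, (f : 𝒢.automorphicQuotient → ℂ) (m • x) = χ m⁻¹ * f x := by
  have h1 := 𝒢.rightRegular_apply_coeFn μ m⁻¹ f
  rw [hf _ (M.inv_mem hm), inv_inv] at h1
  filter_upwards [h1, Lp.coeFn_smul (χ m⁻¹) f] with x hx hx'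
  rw [← hx, hx', Pi.smul_apply, smul_eq_mul]

/-- **Products of `M`-eigenfunctions with the same character are a.e. constant** (`M` closed normal with `M · (A_G · G(K))` dense).  Let
`a, b ∈ L²` satisfy `R(m) a = χ(m) a`, `R(m) b = χ(m) b` for every `m ∈ M`, one function `χ`, with `a ≠ 0` (so `|χ(m)| = 1` on `M`).  Then
`x ↦ ⟪a x, b x⟫` is an `M`-invariant integrable function, hence a.e. the constant `⟪a, b⟫ / μ(X)` (the `M`-version of ★ `inner_coeFn_ae_eq_const`).
[cite: Zimmer1984, §2.2 Cor. 2.2.3] -/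
theorem inner_coeFn_ae_eq_const_of_forall_mem (hM : IsClosed (M : Set 𝒢.Adelic))
    (hd : Dense ((M : Set 𝒢.Adelic) * (𝒢.quotientSubgroup : Set 𝒢.Adelic))) {a b : 𝒢.L2 μ} {χ : 𝒢.Adelic → ℂ}
    (ha : ∀ m ∈ M, 𝒢.rightRegular μ m a = χ m • a) (hb : ∀ m ∈ M, 𝒢.rightRegular μ m b = χ m • b) (ha0 : a ≠ 0) :
    (fun x => ⟪(a : 𝒢.automorphicQuotient → ℂ) x, (b : 𝒢.automorphicQuotient → ℂ) x⟫_ℂ) =ᵐ[μ]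
      Function.const _ ((μ.real univ)⁻¹ • ⟪a, b⟫_ℂ) := by
  haveI := 𝒢.ergodicSMul_subgroup_automorphicQuotient μ M hM hd
  have hχ : ∀ m ∈ M, ‖χ m‖ = 1 := by
    intro m hm
    have h := 𝒢.norm_rightRegular_apply μ m a
    rw [ha m hm, norm_smul] at h
    exact (mul_eq_right₀ (norm_ne_zero_iff.2 ha0)).1 h
  set F : 𝒢.automorphicQuotient → ℂ := fun x =>
    ⟪(a : 𝒢.automorphicQuotient → ℂ) x, (b : 𝒢.automorphicQuotient → ℂ) x⟫_ℂ with hF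
  have hFm : AEStronglyMeasurable F μ :=
    (Lp.aestronglyMeasurable a).inner (Lp.aestronglyMeasurable b)
  have hFinv : ∀ m : M, (fun x => F (m • x)) =ᵐ[μ] F := by
    intro m
    filter_upwards [𝒢.coeFn_smul_ae_eq_of_forall_mem_rightRegular_apply_eq_smul μ M ha m.2,
      𝒢.coeFn_smul_ae_eq_of_forall_mem_rightRegular_apply_eq_smul μ M hb m.2] with x hxa hxb
    simp only [hF, Subgroup.smul_def, hxa, hxb]
    rw [← smul_eq_mul, ← smul_eq_mul, inner_smul_left, inner_smul_right, ← mul_assoc,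
      RCLike.conj_mul, hχ _ (M.inv_mem m.2)]
    simp
  obtain ⟨c, hc⟩ := ae_eq_const_of_forall_smul_ae_eq (G := M) hFm hFinv
  have hint : ∫ x, F x ∂μ = ⟪a, b⟫_ℂ := (L2.inner_def a b).symm
  have hint' : ∫ x, F x ∂μ = (μ.real univ) • c := by
    rw [integral_congr_ae hc]
    exact integral_const c
  have hc' : c = (μ.real univ)⁻¹ • ⟪a, b⟫_ℂ := by
    rw [← hint, hint', smul_smul, inv_mul_cancel₀ (𝒢.measureReal_univ_ne_zero μ), one_smul]
  rw [← hc']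
  exact hc

/-- **An `M`-eigenfunction orthogonal to a non-zero `M`-eigenfunction with the same character vanishes** (`M` closed normal with
`M · (A_G · G(K))` dense; the `M`-version of ★ `eq_zero_of_inner_eq_zero_of_rightRegular_apply_eq_smul`): the `M`-invariant functions `ā b` and
`|a|²` are a.e. the constants `0` and `‖a‖² / μ(X) ≠ 0`. [cite: Zimmer1984, §2.2 Cor. 2.2.3] -/
theorem eq_zero_of_inner_eq_zero_of_forall_mem_rightRegular_apply_eq_smul (hM : IsClosed (M : Set 𝒢.Adelic))
    (hd : Dense ((M : Set 𝒢.Adelic) * (𝒢.quotientSubgroup : Set 𝒢.Adelic))) {a b : 𝒢.L2 μ} {χ : 𝒢.Adelic → ℂ}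
    (ha : ∀ m ∈ M, 𝒢.rightRegular μ m a = χ m • a) (hb : ∀ m ∈ M, 𝒢.rightRegular μ m b = χ m • b) (ha0 : a ≠ 0)
    (hab : ⟪a, b⟫_ℂ = 0) : b = 0 := by
  have h1 := 𝒢.inner_coeFn_ae_eq_const_of_forall_mem μ M hM hd ha hb ha0
  have h2 := 𝒢.inner_coeFn_ae_eq_const_of_forall_mem μ M hM hd ha ha ha0
  rw [hab, smul_zero] at h1
  have hc : (μ.real univ)⁻¹ • ⟪a, a⟫_ℂ ≠ 0 :=
    smul_ne_zero (inv_ne_zero (𝒢.measureReal_univ_ne_zero μ)) (inner_self_ne_zero.2 ha0)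
  refine Lp.eq_zero_iff_ae_eq_zero.2 ?_
  filter_upwards [h1, h2] with x hx1 hx2
  simp only [Function.const_apply] at hx1 hx2
  have hax : (a : 𝒢.automorphicQuotient → ℂ) x ≠ 0 := by
    intro h0
    apply hc
    rw [← hx2]
    simp [h0]
  rw [RCLike.inner_apply, mul_eq_zero] at hx1
  rcases hx1 with h | h
  · exact h
  · exact absurd ((map_eq_zero _).1 h) hax

end AdelicGroupData

/-! ## §2 The `M`-eigenspace of an automorphic character is its line -/

namespace AdelicGroupData.AutomorphicCharacter

universe u

variable {K : Type} [Field K] [NumberField K] {𝒢 : AdelicGroupData.{u} K}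
  [LocallyCompactSpace 𝒢.Adelic] [SecondCountableTopology 𝒢.Adelic]
  (ψ : 𝒢.AutomorphicCharacter) (μ : Measure 𝒢.automorphicQuotient) [𝒢.IsAutomorphicMeasure μ]
  (M : Subgroup 𝒢.Adelic) [M.Normal]

/-- **An `L²` function on which a closed normal subgroup `M` with `M · (A_G · G(K))` dense acts by `ψ(m)⁻¹` is a multiple of `[ψ̄]`**: if
`R(m) f = ψ(m)⁻¹ f` for every `m ∈ M` then `f ∈ ℂ [ψ̄]` (★ `lineSubrep`).  The component of `f` orthogonal to `a = [ψ̄]` (an `M`-eigenfunction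
with the same character, ★ `rightRegular_toL2`) is an `M`-eigenfunction orthogonal to `a ≠ 0`, hence `0`
(`eq_zero_of_inner_eq_zero_of_forall_mem_rightRegular_apply_eq_smul`).  The `M`-version of ★ `mem_lineSubrep_of_forall_rightRegular_apply_eq_smul`
(which needs ALL of `G(𝔸_K)`). [cite: Zimmer1984, §2.2 Cor. 2.2.3] -/
theorem mem_lineSubrep_of_forall_mem_rightRegular_apply_eq_smul (hM : IsClosed (M : Set 𝒢.Adelic))
    (hd : Dense ((M : Set 𝒢.Adelic) * (𝒢.quotientSubgroup : Set 𝒢.Adelic))) {f : 𝒢.L2 μ}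
    (hf : ∀ m ∈ M, 𝒢.rightRegular μ m f = ((ψ m : ℂˣ) : ℂ)⁻¹ • f) : f ∈ ψ.lineSubrep μ := by
  have ha : ∀ m ∈ M, 𝒢.rightRegular μ m (ψ.toL2 μ) = (fun g : 𝒢.Adelic => ((ψ g : ℂˣ) : ℂ)⁻¹) m • ψ.toL2 μ := fun m _ =>
    ψ.rightRegular_toL2 μ m
  have hb : ∀ m ∈ M, 𝒢.rightRegular μ m f = (fun g : 𝒢.Adelic => ((ψ g : ℂˣ) : ℂ)⁻¹) m • f := hf
  have ha0 : ψ.toL2 μ ≠ 0 := ψ.toL2_ne_zero μ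
  have hh : ∀ m ∈ M, 𝒢.rightRegular μ m (f - (⟪ψ.toL2 μ, f⟫_ℂ / ⟪ψ.toL2 μ, ψ.toL2 μ⟫_ℂ) • ψ.toL2 μ) =
      (fun g : 𝒢.Adelic => ((ψ g : ℂˣ) : ℂ)⁻¹) m • (f - (⟪ψ.toL2 μ, f⟫_ℂ / ⟪ψ.toL2 μ, ψ.toL2 μ⟫_ℂ) • ψ.toL2 μ) := by
    intro m hm
    rw [map_sub, map_smul, ha m hm, hb m hm, smul_sub, smul_comm]
  have horth : ⟪ψ.toL2 μ, f - (⟪ψ.toL2 μ, f⟫_ℂ / ⟪ψ.toL2 μ, ψ.toL2 μ⟫_ℂ) • ψ.toL2 μ⟫_ℂ = 0 := by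
    rw [inner_sub_right, inner_smul_right, div_mul_cancel₀ _ (inner_self_ne_zero.2 ha0), sub_self]
  have h0 : f - (⟪ψ.toL2 μ, f⟫_ℂ / ⟪ψ.toL2 μ, ψ.toL2 μ⟫_ℂ) • ψ.toL2 μ = 0 :=
    𝒢.eq_zero_of_inner_eq_zero_of_forall_mem_rightRegular_apply_eq_smul μ M hM hd ha hh ha0 horth
  rw [sub_eq_zero] at h0
  exact (ψ.mem_lineSubrep_iff μ f).2 ⟨_, h0.symm⟩

/-- **The `ψ⁻¹`-eigenspace OF `M` in `L²` is exactly the line `ℂ [ψ̄]`** (`M` closed normal with `M · (A_G · G(K))` dense).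
[cite: Zimmer1984, §2.2 Cor. 2.2.3] -/
theorem mem_lineSubrep_iff_forall_mem_rightRegular_apply_eq_smul (hM : IsClosed (M : Set 𝒢.Adelic))
    (hd : Dense ((M : Set 𝒢.Adelic) * (𝒢.quotientSubgroup : Set 𝒢.Adelic))) (f : 𝒢.L2 μ) :
    f ∈ ψ.lineSubrep μ ↔ ∀ m ∈ M, 𝒢.rightRegular μ m f = ((ψ m : ℂˣ) : ℂ)⁻¹ • f := by
  refine ⟨fun hf m _ => ?_, ψ.mem_lineSubrep_of_forall_mem_rightRegular_apply_eq_smul μ M hM hd⟩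
  obtain ⟨a, rfl⟩ := (ψ.mem_lineSubrep_iff μ f).1 hf
  rw [map_smul, ψ.rightRegular_toL2 μ m, smul_comm]

/-- **A closed invariant subspace of `L²` on which `M` acts by the scalars `ψ(m)⁻¹` lies in the line `ℂ [ψ̄]`** (`M` closed normal with
`M · (A_G · G(K))` dense). [cite: Zimmer1984, §2.2 Cor. 2.2.3] -/
theorem closedSubrep_le_lineSubrep_of_forall_mem_apply_eq_smul (hM : IsClosed (M : Set 𝒢.Adelic))
    (hd : Dense ((M : Set 𝒢.Adelic) * (𝒢.quotientSubgroup : Set 𝒢.Adelic)))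
    {W : ContRepresentation.ClosedSubrep (𝒢.rightRegular μ)}
    (hW : ∀ m ∈ M, ∀ v : W.toSubmodule, W.toContRep m v = ((ψ m : ℂˣ) : ℂ)⁻¹ • v) : W ≤ ψ.lineSubrep μ := by
  intro v hv
  refine ψ.mem_lineSubrep_of_forall_mem_rightRegular_apply_eq_smul μ M hM hd fun m hm => ?_
  have h1 := congrArg Subtype.val (hW m hm ⟨v, hv⟩)
  rw [ContRepresentation.ClosedSubrep.coe_toContRep_apply] at h1
  exact h1

/-- **A NON-ZERO closed invariant subspace of `L²` on which `M` acts by the scalars `ψ(m)⁻¹` IS the line `ℂ [ψ̄]`** (`M` closed normal with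
`M · (A_G · G(K))` dense; the line is topologically irreducible, ★ `isTopIrreducible_lineSubrep`). [cite: Zimmer1984, §2.2 Cor. 2.2.3] -/
theorem closedSubrep_eq_lineSubrep_of_forall_mem_apply_eq_smul (hM : IsClosed (M : Set 𝒢.Adelic))
    (hd : Dense ((M : Set 𝒢.Adelic) * (𝒢.quotientSubgroup : Set 𝒢.Adelic)))
    {W : ContRepresentation.ClosedSubrep (𝒢.rightRegular μ)}
    (hW : ∀ m ∈ M, ∀ v : W.toSubmodule, W.toContRep m v = ((ψ m : ℂˣ) : ℂ)⁻¹ • v) (hnt : Nontrivial W.toSubmodule) :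
    W = ψ.lineSubrep μ :=
  ContRepresentation.ClosedSubrep.eq_of_le_of_isTopIrreducible (ψ.isTopIrreducible_lineSubrep μ) hnt
    (ψ.closedSubrep_le_lineSubrep_of_forall_mem_apply_eq_smul μ M hM hd hW)

end AdelicGroupData.AutomorphicCharacter

/-! ## §3 Discrete automorphic representations on which `M` acts by scalars -/

namespace DiscreteAutomorphicRep

universe u

variable {K : Type} [Field K] [NumberField K] {𝒢 : AdelicGroupData.{u} K}
  [LocallyCompactSpace 𝒢.Adelic] [SecondCountableTopology 𝒢.Adelic]
  (μ : Measure 𝒢.automorphicQuotient) [𝒢.IsAutomorphicMeasure μ]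
  (M : Subgroup 𝒢.Adelic) [M.Normal]

/-- **A discrete automorphic representation on which a closed normal subgroup `M` with `M · (A_G · G(K))` dense acts by the scalars `ψ(m)⁻¹`
IS `ofChar ψ μ`** — the line of the automorphic character `ψ̄`; in particular it is one-dimensional and ALL of `G(𝔸_K)` acts on it by `ψ(g)⁻¹`.
For `M = G(𝔸_{K,f})` (density = weak approximation at `∞`) this is «an automorphic representation on which the finite adelic group acts by a
character is that character» — residual (iii) of the LH7 O8b census. (The two structures have the same `space`, ★
`DiscreteAutomorphicRep.eq_ofChar_iff_forall_apply_eq_smul` finishing from the scalar action of all of `G(𝔸_K)` on the line.)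
[cite: Zimmer1984, §2.2 Cor. 2.2.3] -/
theorem eq_ofChar_of_forall_mem_apply_eq_smul (hM : IsClosed (M : Set 𝒢.Adelic))
    (hd : Dense ((M : Set 𝒢.Adelic) * (𝒢.quotientSubgroup : Set 𝒢.Adelic))) (P : DiscreteAutomorphicRep 𝒢 μ)
    (ψ : 𝒢.AutomorphicCharacter) (hP : ∀ m ∈ M, ∀ v : P.space.toSubmodule, P.space.toContRep m v = ((ψ m : ℂˣ) : ℂ)⁻¹ • v) :
    P = ofChar ψ μ := by
  have hsp : P.space = ψ.lineSubrep μ :=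
    ψ.closedSubrep_eq_lineSubrep_of_forall_mem_apply_eq_smul μ M hM hd hP P.nontrivial_space
  refine (P.eq_ofChar_iff_forall_apply_eq_smul μ ψ).2 fun g v => ?_
  have hv : (v : 𝒢.L2 μ) ∈ ψ.lineSubrep μ := hsp ▸ v.2
  obtain ⟨a, ha⟩ := (ψ.mem_lineSubrep_iff μ (v : 𝒢.L2 μ)).1 hv
  apply Subtype.ext
  rw [ContRepresentation.ClosedSubrep.coe_toContRep_apply, Submodule.coe_smul, ← ha, map_smul,
    ψ.rightRegular_toL2 μ g, smul_comm]

/-- **Multiplicity one, `M`-form**: two discrete automorphic representations on which `M` acts by the same scalars `ψ(m)⁻¹` coincide (both are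
`ofChar ψ μ`). [cite: Zimmer1984, §2.2 Cor. 2.2.3] -/
theorem eq_of_forall_mem_apply_eq_smul (hM : IsClosed (M : Set 𝒢.Adelic))
    (hd : Dense ((M : Set 𝒢.Adelic) * (𝒢.quotientSubgroup : Set 𝒢.Adelic))) (P P' : DiscreteAutomorphicRep 𝒢 μ)
    (ψ : 𝒢.AutomorphicCharacter) (hP : ∀ m ∈ M, ∀ v : P.space.toSubmodule, P.space.toContRep m v = ((ψ m : ℂˣ) : ℂ)⁻¹ • v)
    (hP' : ∀ m ∈ M, ∀ v : P'.space.toSubmodule, P'.space.toContRep m v = ((ψ m : ℂˣ) : ℂ)⁻¹ • v) : P = P' := by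
  rw [eq_ofChar_of_forall_mem_apply_eq_smul μ M hM hd P ψ hP, eq_ofChar_of_forall_mem_apply_eq_smul μ M hM hd P' ψ hP']

/-- **`M`-scalar discrete automorphic representations are one-dimensional.** [cite: Zimmer1984, §2.2 Cor. 2.2.3] -/
theorem isOneDimensional_of_forall_mem_apply_eq_smul (hM : IsClosed (M : Set 𝒢.Adelic))
    (hd : Dense ((M : Set 𝒢.Adelic) * (𝒢.quotientSubgroup : Set 𝒢.Adelic))) (P : DiscreteAutomorphicRep 𝒢 μ)
    (ψ : 𝒢.AutomorphicCharacter) (hP : ∀ m ∈ M, ∀ v : P.space.toSubmodule, P.space.toContRep m v = ((ψ m : ℂˣ) : ℂ)⁻¹ • v) :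
    P.IsOneDimensional := by
  rw [eq_ofChar_of_forall_mem_apply_eq_smul μ M hM hd P ψ hP]
  exact isOneDimensional_ofChar ψ μ

end DiscreteAutomorphicRep

end Literature.NumberTheory.Automorphic
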